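import Summits.QuantumFields.YangMills.Theorems.BalabanUVNodesPortS1RecordDtJacReal
import Literature.Analysis.Complex.LogOnePlus
import Literature.Analysis.Matrix.DetExp

/-!
# Port S1, socket (o3)-VI — THE `Tr log` FORM OF THE `D̃`-JACOBIAN: `det(1 + h_ℂ∘DC̃_ℂ(B′)) = exp Tr log(1 + h_ℂ∘DC̃_ℂ(B′))` (series logarithm, `‖h_ℂ∘DC̃_ℂ(B′)‖ ≤ 9C₂bρ < 1`),
# `B′ ↦ Tr log(1 + h_ℂ∘DC̃_ℂ(B′))` IS ANALYTIC ON THE `2ρ`-BALL AND VANISHES AT `0`, AND ★★ DEF-1's `recordDtJacOf` AT THE `recordDt` FAMILY `= −Re Tr log(1 + h_ℂ∘DC̃_ℂ(↑Y_g(x)))`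
# ([I] (2.12) p.268 «− Tr log(I − h((δ∕δB)D̃)(g_kCB))», with `I − h δD̃∕δB = (1 + h_ℂ DC̃_ℂ(B′))⁻¹` at `B′ = Φ(B)`, ✓`…PortS1RecordDtHol`)

Cell `ym-nodeO-ideate`, porter seat PT-A-1 (gen 10); `--kind proof --supports stmt-QuantumFields-27930 --as helper`; count-neutral.  [I] = [Balaban1987RG1]; [15] = [Balaban1985Variational].
Director-ym R702-ym docket (1) «(o3) det∕Tr-log of `1 + h_ℂ∘DC̃_ℂ(B′)`» — the `Tr log` half, over ✓`…PortS1RecordDtJacReal` (p828921: `recordDtJacOf = −log‖det DΨ(↑Y)‖`), the tree's series logarithm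
✓`Literature.Analysis.Complex.logOnePlus` (`exp_logOnePlus`, `analyticAt_logOnePlus`, `norm_logOnePlus_le`) and Liouville's formula ✓`Literature.Analysis.Matrix.det_exp_eq_exp_trace`.

WHAT IS PROVED (`𝒴 := FluctIdx → ℂ` with the sup norm; `T(B′) := h_ℂ ∘L DC̃_ℂ(B′)`; letters (o1-ε) at a quantified radius `ρ`, `R = 1∕(10⁸dL)`, `C₂ = 2∕R²`):
* §1 [folklore] `det_one_add_eq_exp_trace_logOnePlus` — for `A : 𝒴 →L[ℂ] 𝒴` with `‖A‖ < 1`: `det(1 + A) = exp(Tr logOnePlus A)` (`exp logOnePlus A = 1 + A` in the Banach algebra `𝒴 →L 𝒴`, transported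
  to matrices along the continuous algebra equivalence `Module.End.toContinuousLinearMap⁻¹ ≫ toMatrixAlgEquiv'` by Mathlib `map_exp`, then `det exp = exp Tr`); `log_norm_det_one_add` (`log‖det(1+A)‖ = Re Tr log(1+A)`);
  `norm_trace_le_card_mul` (`‖Tr L‖ ≤ #ι · ‖L‖`, sup-operator norm).
* §2 ★★ `det_fderiv_recordPsi_eq_exp_trace_logOnePlus` (`‖B′‖ < 2ρ`), ★ `log_norm_det_fderiv_recordPsi_eq_re_trace`, ★★★ `recordDtJacOf_recordDt_eq_neg_re_trace_logOnePlus` — DEF-1's (o3) socket at the record family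
  IS print's `−Tr log`, read through `Re` on the real slice: `recordDtJacOf F k (fun Vk => recordDt F k K Vk ρ) Vk g x = −Re Tr logOnePlus (T(↑Y_g(x)))`, `Y_g(x) = recordReparamOf … g x`, `‖↑(g•x)‖ < ρ`.
* §3 ★★ `analyticOnNhd_trace_logOnePlus_hop_comp_fderiv_recordCtC` — `B′ ↦ Tr logOnePlus (T B′)` is ANALYTIC on `ball 0 (2ρ)` (`DC̃_ℂ` analytic as the `fderiv` of an analytic map; `A ↦ h_ℂ ∘L A` and `Tr` continuous
  linear; `logOnePlus` analytic on the unit ball); `trace_logOnePlus_hop_comp_fderiv_recordCtC_zero` (value `0` at `B′ = 0`: `DC̃_ℂ(0) = 0`); ★ `norm_trace_logOnePlus_hop_comp_fderiv_recordCtC_le` — the crude GLOBAL bound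
  `‖Tr log(1 + T B′)‖ ≤ #FluctIdx · 9C₂bρ∕(1 − 9C₂bρ)` (EXTENSIVE in the volume, as a total effective-action term must be; the per-cube `O(1)` size is LOCALITY, [I] §3, not here).

HONEST FRAMING.  Banach-algebra bookkeeping (series log, Liouville) over landed estimates; the LOCALIZATION of `Tr log(1 + h_ℂ∘DC̃_ℂ)` into pieces with `e^{−κ d(X)}` decay ([I] §3 (3.20)ff via [15]'s expansions of
`D̃`, `h`, `δD̃∕δB`) — the actual Theorem-3 content of this term — is NOT here; nothing of Bałaban's renormalization-group estimates asserted, ported or discharged beyond this; `stub_FE` (XXL) ∕ `stub_P0C` OPEN,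
⟨27930⟩ OPEN (1∕3); NODE O 0∕1; COUNT 8∕28 · K 1∕4 UNMOVED; finite `𝕋⁴_{L^K}` at fixed ε — NOT continuum ∕ OS; **the Yang–Mills mass gap (Clay) is NOT proved by any of this.**  No `sorry`, no `def`,
no `instance` (two `letI` normed structures INSIDE one folklore proof, for Mathlib `map_exp`); standard axioms only.
-/

noncomputable section

open scoped BigOperators Matrix.Norms.L2Operator Topology

open Set Metric Filter

namespace Summit.QuantumFields.YangMills.Theorems.BalabanUVNodesPortS1

open Summit.QuantumFields.YangMills.Theorems.K0RecordFormatNames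
open Literature.MathematicalPhysics.QuantumFieldTheory.Balaban1983to89
open Literature.MathematicalPhysics.QuantumFieldTheory.Balaban1983to89.Node00
open Literature.MathematicalPhysics.QuantumFieldTheory.Balaban1983to89.T4Continuum (T4Family)
open Literature.MathematicalPhysics.QuantumFieldTheory.Balaban1983to89.BlockAveraging (Small Idx)
open Literature.MathematicalPhysics.QuantumFieldTheory.Balaban1983to89.ExpMeanLog (expMeanLogSU)
open Literature.Analysis.Complex (logOnePlus exp_logOnePlus analyticAt_logOnePlus norm_logOnePlus_le logOnePlus_zero)
open _root_.Matrix

/-! ## §1  Folklore: `det(1 + A) = exp Tr log(1 + A)` for a small operator on `ι → ℂ` -/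

section Folklore

variable {ι : Type*} [Fintype ι] [DecidableEq ι]

/-- **`det(1 + A) = exp(Tr logOnePlus A)`** for `A : (ι → ℂ) →L[ℂ] (ι → ℂ)` with `‖A‖ < 1`: `exp (logOnePlus A) = 1 + A` in the Banach algebra of operators, transported to matrices along the continuous
algebra equivalence (Mathlib `map_exp`), where `det ∘ exp = exp ∘ Tr` (Liouville, tree ✓`det_exp_eq_exp_trace`). [folklore] -/
theorem det_one_add_eq_exp_trace_logOnePlus (A : (ι → ℂ) →L[ℂ] (ι → ℂ)) (hA : ‖A‖ < 1) :
    LinearMap.det ((1 + A : (ι → ℂ) →L[ℂ] (ι → ℂ)) : (ι → ℂ) →ₗ[ℂ] (ι → ℂ)) =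
      Complex.exp (LinearMap.trace ℂ (ι → ℂ) ((logOnePlus A : (ι → ℂ) →L[ℂ] (ι → ℂ)) : (ι → ℂ) →ₗ[ℂ] (ι → ℂ))) := by
  set L : (ι → ℂ) →L[ℂ] (ι → ℂ) := logOnePlus A with hL
  have hexp : NormedSpace.exp L = 1 + A := exp_logOnePlus hA
  let Φ : ((ι → ℂ) →L[ℂ] (ι → ℂ)) ≃ₐ[ℂ] Matrix ι ι ℂ :=
    (Module.End.toContinuousLinearMap (𝕜 := ℂ) (ι → ℂ)).symm.trans LinearMap.toMatrixAlgEquiv'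
  have hΦ : ∀ B : (ι → ℂ) →L[ℂ] (ι → ℂ), Φ B = LinearMap.toMatrix' (B : (ι → ℂ) →ₗ[ℂ] (ι → ℂ)) := fun B => rfl
  have hΦc : Continuous Φ := Φ.toLinearEquiv.toLinearMap.continuous_of_finiteDimensional
  have hmap : Φ (NormedSpace.exp L) = NormedSpace.exp (Φ L) := by
    letI : NormedRing (Matrix ι ι ℂ) := Matrix.linftyOpNormedRing
    letI : NormedAlgebra ℚ ((ι → ℂ) →L[ℂ] (ι → ℂ)) := NormedAlgebra.restrictScalars ℚ ℂ _
    exact NormedSpace.map_exp Φ hΦc L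
  have hdet : LinearMap.det ((1 + A : (ι → ℂ) →L[ℂ] (ι → ℂ)) : (ι → ℂ) →ₗ[ℂ] (ι → ℂ)) = (Φ (NormedSpace.exp L)).det := by
    rw [hexp, hΦ, LinearMap.det_toMatrix']
  rw [hdet, hmap, Literature.Analysis.Matrix.det_exp_eq_exp_trace, Complex.exp_eq_exp_ℂ, hΦ,
    LinearMap.trace_eq_matrix_trace ℂ (Pi.basisFun ℂ ι) (L : (ι → ℂ) →ₗ[ℂ] (ι → ℂ)), LinearMap.toMatrix_eq_toMatrix']

/-- `log ‖det(1 + A)‖ = Re Tr logOnePlus A` for `‖A‖ < 1`. [folklore] -/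
theorem log_norm_det_one_add (A : (ι → ℂ) →L[ℂ] (ι → ℂ)) (hA : ‖A‖ < 1) :
    Real.log ‖LinearMap.det ((1 + A : (ι → ℂ) →L[ℂ] (ι → ℂ)) : (ι → ℂ) →ₗ[ℂ] (ι → ℂ))‖ =
      (LinearMap.trace ℂ (ι → ℂ) ((logOnePlus A : (ι → ℂ) →L[ℂ] (ι → ℂ)) : (ι → ℂ) →ₗ[ℂ] (ι → ℂ))).re := by
  rw [det_one_add_eq_exp_trace_logOnePlus A hA, Complex.norm_exp, Real.log_exp]

/-- `‖Tr L‖ ≤ #ι · ‖L‖` for an operator on `ι → ℂ` with the sup-operator norm (`Tr L = Σ_i (L e_i)_i`, `|(L e_i)_i| ≤ ‖L e_i‖ ≤ ‖L‖`). [folklore] -/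
theorem norm_trace_le_card_mul (L : (ι → ℂ) →L[ℂ] (ι → ℂ)) :
    ‖LinearMap.trace ℂ (ι → ℂ) (L : (ι → ℂ) →ₗ[ℂ] (ι → ℂ))‖ ≤ Fintype.card ι * ‖L‖ := by
  rw [LinearMap.trace_eq_matrix_trace ℂ (Pi.basisFun ℂ ι), LinearMap.toMatrix_eq_toMatrix', Matrix.trace]
  calc ‖∑ i, Matrix.diag (LinearMap.toMatrix' (L : (ι → ℂ) →ₗ[ℂ] (ι → ℂ))) i‖
      ≤ ∑ i, ‖Matrix.diag (LinearMap.toMatrix' (L : (ι → ℂ) →ₗ[ℂ] (ι → ℂ))) i‖ := norm_sum_le _ _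
    _ ≤ ∑ _i : ι, ‖L‖ := Finset.sum_le_sum fun i _ => by
        rw [Matrix.diag_apply, LinearMap.toMatrix'_apply, ContinuousLinearMap.coe_coe]
        calc ‖L (Pi.single i 1) i‖ ≤ ‖L (Pi.single i 1)‖ := norm_le_pi_norm _ i
          _ ≤ ‖L‖ * ‖(Pi.single i (1 : ℂ) : ι → ℂ)‖ := L.le_opNorm _
          _ ≤ ‖L‖ := by rw [Pi.norm_single, norm_one, mul_one]
    _ = Fintype.card ι * ‖L‖ := by rw [Finset.sum_const, Finset.card_univ, nsmul_eq_mul]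

end Folklore

/-! ## §2  At the record: `det DΨ(B′) = exp Tr log(1 + h_ℂ∘DC̃_ℂ(B′))`, and DEF-1's `recordDtJacOf = −Re Tr log` -/

section Letters

variable {F : T4Family}
variable {k K : ℕ} (hk : k + 1 ≤ (F.P K).m + (F.P K).K) (Vk : GaugeField (F.P K) k (SU 2)) {ε : ℝ}
  (hε : ∀ (c : PBond (F.P K) (k + 1)) (i : Idx (F.P K)), ‖loopM (coeField Vk) c i - 1‖ ≤ ε) (hε50 : ε ≤ 1 / 50)
  (hVk : ∀ c, Small expMeanLogSU Vk c) {b ρ : ℝ} (hb : 0 ≤ b) (hHop : ∀ X, ‖hopLinGraphC F k K Vk X‖ ≤ b * ‖X‖)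
  (hq : 9 * (2 * 1 / (1 / (10 ^ 8 * (F.P K).d * (F.P K).L)) ^ 2) * b * ρ < 1) (hρ : 3 * ρ ≤ 1 / (10 ^ 8 * (F.P K).d * (F.P K).L))

include hk hε hε50 hVk hb hHop hq hρ in
/-- ★★ **`det DΨ(B′) = exp Tr logOnePlus(h_ℂ∘DC̃_ℂ(B′))`** for `‖B′‖ < 2ρ` (`‖h_ℂ∘DC̃_ℂ(B′)‖ ≤ 9C₂bρ < 1`, ✓`isUnit_fderiv_recordPsi_of_lt_two_mul`). [cite: Balaban1987RG1, (2.12) p.268] -/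
theorem det_fderiv_recordPsi_eq_exp_trace_logOnePlus {Y : FluctIdx F k K → ℂ} (hY : ‖Y‖ < 2 * ρ) :
    LinearMap.det (((1 : (FluctIdx F k K → ℂ) →L[ℂ] (FluctIdx F k K → ℂ)) +
        (LinearMap.toContinuousLinearMap (hopLinGraphC F k K Vk)).comp (fderiv ℂ (recordCtC F k K Vk) Y)).toLinearMap) =
      Complex.exp (LinearMap.trace ℂ (FluctIdx F k K → ℂ)
        (logOnePlus ((LinearMap.toContinuousLinearMap (hopLinGraphC F k K Vk)).comp (fderiv ℂ (recordCtC F k K Vk) Y))).toLinearMap) :=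
  det_one_add_eq_exp_trace_logOnePlus _ (isUnit_fderiv_recordPsi_of_lt_two_mul F k K hk Vk hε hε50 hVk hb hHop hq hρ hY).1

include hk hε hε50 hVk hb hHop hq hρ in
/-- ★ `log ‖det DΨ(B′)‖ = Re Tr logOnePlus(h_ℂ∘DC̃_ℂ(B′))` for `‖B′‖ < 2ρ`. [cite: Balaban1987RG1, (2.12) p.268] -/
theorem log_norm_det_fderiv_recordPsi_eq_re_trace {Y : FluctIdx F k K → ℂ} (hY : ‖Y‖ < 2 * ρ) :
    Real.log ‖LinearMap.det (((1 : (FluctIdx F k K → ℂ) →L[ℂ] (FluctIdx F k K → ℂ)) +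
        (LinearMap.toContinuousLinearMap (hopLinGraphC F k K Vk)).comp (fderiv ℂ (recordCtC F k K Vk) Y)).toLinearMap)‖ =
      (LinearMap.trace ℂ (FluctIdx F k K → ℂ)
        (logOnePlus ((LinearMap.toContinuousLinearMap (hopLinGraphC F k K Vk)).comp (fderiv ℂ (recordCtC F k K Vk) Y))).toLinearMap).re :=
  log_norm_det_one_add _ (isUnit_fderiv_recordPsi_of_lt_two_mul F k K hk Vk hε hε50 hVk hb hHop hq hρ hY).1

include hk hε hε50 hVk hb hHop hq hρ in
/-- ★★★ **DEF-1's (o3) SOCKET AT THE RECORD FAMILY IS PRINT's `−Tr log`, READ THROUGH `Re` ON THE REAL SLICE**: for `‖↑(g•x)‖ < ρ`,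
`recordDtJacOf F k (fun Vk => recordDt F k K Vk ρ) Vk g x = −Re Tr logOnePlus(h_ℂ ∘L DC̃_ℂ(↑Y))`, `Y = recordReparamOf F k (fun Vk => recordDt F k K Vk ρ) Vk g x` — (2.12)'s «− Tr log(I − h(δ∕δB)D̃)(g_kCB)»
is `+log|det(I − hδD̃∕δB)|` there with the opposite sign convention inside `𝐏`; here `log|det(1 − h_ℂDD̃)(↑(g•x))| = −Re Tr log(1 + h_ℂ DC̃_ℂ(↑Y))` exactly. [cite: Balaban1987RG1, (2.12) p.268, p.267] -/
theorem recordDtJacOf_recordDt_eq_neg_re_trace_logOnePlus (g : ℝ) (x : FluctIdx F k K → ℝ) (hgx : ‖(fun i => ((g • x) i : ℂ))‖ < ρ) :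
    recordDtJacOf F k (fun Vk => recordDt F k K Vk ρ) Vk g x =
      -(LinearMap.trace ℂ (FluctIdx F k K → ℂ)
        (logOnePlus ((LinearMap.toContinuousLinearMap (hopLinGraphC F k K Vk)).comp
          (fderiv ℂ (recordCtC F k K Vk) (fun i => ((recordReparamOf F k (fun Vk => recordDt F k K Vk ρ) Vk g x) i : ℂ))))).toLinearMap).re := by
  rw [recordDtJacOf_recordDt hk Vk hε hε50 hVk hb hHop hq hρ g x hgx,
    log_norm_det_fderiv_recordPsi_eq_re_trace hk Vk hε hε50 hVk hb hHop hq hρ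
      (norm_ofReal_recordReparamOf_recordDt_lt hk Vk hε hε50 hVk hb hHop hq hρ g x hgx)]

/-! ## §3  `B′ ↦ Tr log(1 + h_ℂ∘DC̃_ℂ(B′))` is analytic on the `2ρ`-ball, vanishes at `0`, crude size -/

include hk hε hε50 hVk hb hHop hq hρ in
/-- ★★ **ANALYTICITY OF THE `Tr log` JACOBIAN IN `B′`**: `B′ ↦ Tr logOnePlus(h_ℂ ∘L DC̃_ℂ(B′))` is analytic on `ball 0 (2ρ)` — `DC̃_ℂ` is analytic on the `R`-ball (the Fréchet derivative of an analytic map),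
`A ↦ h_ℂ ∘L A` and `Tr` are continuous linear, and `logOnePlus` is analytic on the open unit ball of the operator algebra, which contains `h_ℂ∘DC̃_ℂ(B′)` for `‖B′‖ < 2ρ`.
[cite: Balaban1987RG1, (2.12) p.268, (1.18) p.263 («analytic function»)] -/
theorem analyticOnNhd_trace_logOnePlus_hop_comp_fderiv_recordCtC :
    AnalyticOnNhd ℂ (fun Y : FluctIdx F k K → ℂ => LinearMap.trace ℂ (FluctIdx F k K → ℂ)
        (logOnePlus ((LinearMap.toContinuousLinearMap (hopLinGraphC F k K Vk)).comp (fderiv ℂ (recordCtC F k K Vk) Y))).toLinearMap)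
      (ball (0 : FluctIdx F k K → ℂ) (2 * ρ)) := by
  intro Y hY
  have hY' : ‖Y‖ < 2 * ρ := mem_ball_zero_iff.1 hY
  have hρ0 : 0 < ρ := by linarith [norm_nonneg Y]
  have hYR : Y ∈ ball (0 : FluctIdx F k K → ℂ) (1 / (10 ^ 8 * (F.P K).d * (F.P K).L)) := mem_ball_zero_iff.2 (by linarith)
  -- `DC̃_ℂ` analytic at `Y`
  have h1 : AnalyticAt ℂ (fderiv ℂ (recordCtC F k K Vk)) Y := (analyticOnNhd_recordCtC_ball F k K hk Vk hε hε50 hVk).fderiv Y hYR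
  -- `A ↦ h_ℂ ∘L A`
  have h2 : AnalyticAt ℂ (fun Y' => (LinearMap.toContinuousLinearMap (hopLinGraphC F k K Vk)).comp (fderiv ℂ (recordCtC F k K Vk) Y')) Y :=
    ((ContinuousLinearMap.compL ℂ (FluctIdx F k K → ℂ) (PBond (F.P K) (k + 1) → MatA 2) (FluctIdx F k K → ℂ))
      (LinearMap.toContinuousLinearMap (hopLinGraphC F k K Vk))).analyticAt _ |>.comp h1
  -- `logOnePlus` analytic at the (small) operator
  have h3 : AnalyticAt ℂ (fun Y' => logOnePlus ((LinearMap.toContinuousLinearMap (hopLinGraphC F k K Vk)).comp (fderiv ℂ (recordCtC F k K Vk) Y'))) Y :=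
    (analyticAt_logOnePlus (isUnit_fderiv_recordPsi_of_lt_two_mul F k K hk Vk hε hε50 hVk hb hHop hq hρ hY').1).comp
      (f := fun Y' => (LinearMap.toContinuousLinearMap (hopLinGraphC F k K Vk)).comp (fderiv ℂ (recordCtC F k K Vk) Y')) (x := Y) h2
  -- `Tr ∘ toLinearMap` is a continuous linear functional on the operator algebra
  have h4 : AnalyticAt ℂ (fun L : (FluctIdx F k K → ℂ) →L[ℂ] (FluctIdx F k K → ℂ) => LinearMap.trace ℂ (FluctIdx F k K → ℂ) L.toLinearMap)
      (logOnePlus ((LinearMap.toContinuousLinearMap (hopLinGraphC F k K Vk)).comp (fderiv ℂ (recordCtC F k K Vk) Y))) := by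
    have := (LinearMap.toContinuousLinearMap ((LinearMap.trace ℂ (FluctIdx F k K → ℂ)).comp (ContinuousLinearMap.coeLM ℂ))).analyticAt
      (logOnePlus ((LinearMap.toContinuousLinearMap (hopLinGraphC F k K Vk)).comp (fderiv ℂ (recordCtC F k K Vk) Y)))
    exact this
  exact h4.comp (f := fun Y' => logOnePlus ((LinearMap.toContinuousLinearMap (hopLinGraphC F k K Vk)).comp (fderiv ℂ (recordCtC F k K Vk) Y'))) (x := Y) h3

include hk hε hε50 hVk in
/-- At `B′ = 0` the `Tr log` Jacobian vanishes (`DC̃_ℂ(0) = 0`). [cite: Balaban1987RG1, (2.12) p.268, (2.14) p.268] -/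
theorem trace_logOnePlus_hop_comp_fderiv_recordCtC_zero :
    LinearMap.trace ℂ (FluctIdx F k K → ℂ)
        (logOnePlus ((LinearMap.toContinuousLinearMap (hopLinGraphC F k K Vk)).comp (fderiv ℂ (recordCtC F k K Vk) 0))).toLinearMap = 0 := by
  rw [(hasFDerivAt_recordCtC_zero F k K hk Vk hε hε50 hVk).fderiv, ContinuousLinearMap.comp_zero, logOnePlus_zero]
  simp

include hk hε hε50 hVk hb hHop hq hρ in
/-- ★ **CRUDE GLOBAL SIZE**: `‖Tr logOnePlus(h_ℂ∘DC̃_ℂ(B′))‖ ≤ #FluctIdx · 9C₂bρ∕(1 − 9C₂bρ)` for `‖B′‖ < 2ρ` — extensive in the number of fluctuation coordinates (a total effective-action term); the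
per-cube `O(1)` bound is the locality content of [I] §3, not this line. [cite: Balaban1987RG1, (2.12) p.268, (3.20) p.272] -/
theorem norm_trace_logOnePlus_hop_comp_fderiv_recordCtC_le {Y : FluctIdx F k K → ℂ} (hY : ‖Y‖ < 2 * ρ) :
    ‖LinearMap.trace ℂ (FluctIdx F k K → ℂ)
        (logOnePlus ((LinearMap.toContinuousLinearMap (hopLinGraphC F k K Vk)).comp (fderiv ℂ (recordCtC F k K Vk) Y))).toLinearMap‖ ≤
      Fintype.card (FluctIdx F k K) * (9 * (2 * 1 / (1 / (10 ^ 8 * (F.P K).d * (F.P K).L)) ^ 2) * b * ρ /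
        (1 - 9 * (2 * 1 / (1 / (10 ^ 8 * (F.P K).d * (F.P K).L)) ^ 2) * b * ρ)) := by
  have hT1 := (isUnit_fderiv_recordPsi_of_lt_two_mul F k K hk Vk hε hε50 hVk hb hHop hq hρ hY).1
  have hTq := norm_hop_comp_fderiv_recordCtC_le_of_lt_two_mul F k K hk Vk hε hε50 hVk hb hHop hρ hY
  have hθ : 0 < 1 - 9 * (2 * 1 / (1 / (10 ^ 8 * (F.P K).d * (F.P K).L)) ^ 2) * b * ρ := sub_pos.2 hq
  refine (norm_trace_le_card_mul _).trans (mul_le_mul_of_nonneg_left ?_ (Nat.cast_nonneg _))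
  refine (norm_logOnePlus_le hT1).trans ?_
  rw [div_le_div_iff₀ (sub_pos.2 hT1) hθ]
  nlinarith [norm_nonneg ((LinearMap.toContinuousLinearMap (hopLinGraphC F k K Vk)).comp (fderiv ℂ (recordCtC F k K Vk) Y))]

end Letters

end Summit.QuantumFields.YangMills.Theorems.BalabanUVNodesPortS1

end
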